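import Summits.Ventures.HodgeRepro.Tier4.Common.AdelicDefs
import Summits.Ventures.HodgeRepro.Tier4.Line1.PlaneDefs

/-!
# Tier4/Line1/ThreeLines — LINE L1: three distinct `E′`-lines force an adelic unitary to be central (t4-L1-p3)

Blind re-derivation cell `pub-hodge-repro`, Tier 4 (README §9–§10), seat t4-L1-p3.  The algebraic half of
J2.d′-i `exists_regular_rational` (Skeleton-v0.13 L431–L435), over typer-2's DEFINED adelic objects
(`Tier4/Common/AdelicDefs.lean`) and the line's `PlaneDefs.lean`, Mathlib only, no printed input:

* `linearIndependent_pair_mulVec`, `range_le_span_pair`: for a genuine plane (`Ω² = −d`, `−d` not a square) an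
  `Ω`-stable `k`-subspace of dimension `2` (an `E′`-line) is spanned by `z, Ωz` for any non-zero `z` in it.
* `mulVec_adMat_mem_span`: the same span statement over the adele ring, for the columns of `adMat A` — no base-change
  theory: every column of `A` is a `k`-combination of `z, Ωz`.
* `mat_eq_scalar_of_three_lines`: an element `t ∈ U(W)(𝔸)` commuting with the projectors `P 0`, `P 1` and with a third
  rank-2 `Ω`-stable projector `f` whose image contains a vector with both `P`-components non-zero is an `E′`-scalar
  `c·1 + e·Ω` (`c, e ∈ 𝔸`): `t z = c z + e Ωz` on such a `z`, hence on `x = P 0 z`, `Ωx`, `y = P 1 z`, `Ωy`, hence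
  `(t − c − eΩ)·adMat (P i) = 0` and `P 0 + P 1 = 1`.
* `mem_center_of_mat_eq_scalar`: an `E′`-scalar is central in `U(W)(𝔸)` (every unitary commutes with `Ω`).
* `isRegularRational_one`: when the line `im (Q 0)` differs from both `im (P 0)` and `im (P 1)`, the identity is a
  regular rational element: `t⁻¹ t′ = 1` puts `t = t′` in `T ∩ T′`, which is the centre by the above.

The complementary half (a rational ROTATION when `T′ = T`, no Witt / no density) is the subject of the next module;
the census line S12438 says why the «declared wall» of J2.d′-i is not one.

Nothing here says anything about the status of the Hodge conjecture for CM abelian varieties, which is NOT proved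
(HC_CM is NOT proved by anyone in this repository).
-/

set_option autoImplicit false

noncomputable section

namespace Summit.Ventures.HodgeRepro.Tier4.Line1

open NumberField Summit.Ventures.HodgeRepro.Tier4.Common Matrix

variable {k : Type} [Field k] [NumberField k] (W : PlaneData k)

/-- `z` and `Ωz` are linearly independent over `k` for `z ≠ 0` when `Ω² = −d` with `−d` not a square. -/
theorem linearIndependent_pair_mulVec {d : k} (hΩ : W.Ω * W.Ω = -(d • (1 : Matrix (Fin 4) (Fin 4) k)))
    (hd : ¬ IsSquare (-d)) {z : Fin 4 → k} (hz : z ≠ 0) :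
    LinearIndependent k ![z, W.Ω *ᵥ z] := by
  rw [LinearIndependent.pair_iff]
  intro s t hst
  by_cases ht : t = 0
  · subst ht
    simp only [zero_smul, add_zero, smul_eq_zero] at hst
    exact ⟨hst.resolve_right hz, rfl⟩
  · exfalso
    have h1 : W.Ω *ᵥ z = (-(s / t)) • z := by
      have h0 : t • (W.Ω *ᵥ z) = -(s • z) := by
        rw [eq_neg_iff_add_eq_zero, add_comm]
        exact hst
      calc W.Ω *ᵥ z = t⁻¹ • (t • (W.Ω *ᵥ z)) := by rw [smul_smul, inv_mul_cancel₀ ht, one_smul]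
        _ = t⁻¹ • (-(s • z)) := by rw [h0]
        _ = (-(s / t)) • z := by rw [smul_neg, smul_smul, neg_smul, div_eq_inv_mul]
    set c := -(s / t) with hc
    have h2 : W.Ω *ᵥ (W.Ω *ᵥ z) = (c * c) • z := by
      rw [h1, mulVec_smul, h1, smul_smul]
    have h3 : W.Ω *ᵥ (W.Ω *ᵥ z) = (-d) • z := by
      rw [mulVec_mulVec, hΩ, neg_mulVec, smul_mulVec, one_mulVec, neg_smul]
    have h4 : (c * c - (-d)) • z = 0 := by
      rw [sub_smul, ← h2, ← h3, sub_self]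
    rcases smul_eq_zero.mp h4 with h | h
    · exact hd ⟨c, by linear_combination -h⟩
    · exact hz h

/-- an `Ω`-stable rank-`2` subspace (an `E′`-line) is spanned by `z, Ωz` for any non-zero `z` in it. -/
theorem range_le_span_pair {d : k} (hΩ : W.Ω * W.Ω = -(d • (1 : Matrix (Fin 4) (Fin 4) k)))
    (hd : ¬ IsSquare (-d)) {A : Matrix (Fin 4) (Fin 4) k} (hA : A * W.Ω = W.Ω * A) (hr : A.rank = 2)
    {z : Fin 4 → k} (hz : z ≠ 0) (hzA : z ∈ LinearMap.range A.mulVecLin) :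
    LinearMap.range A.mulVecLin ≤ Submodule.span k {z, W.Ω *ᵥ z} := by
  have hle : Submodule.span k {z, W.Ω *ᵥ z} ≤ LinearMap.range A.mulVecLin := by
    rw [Submodule.span_le]
    rintro v hv
    simp only [Set.mem_insert_iff, Set.mem_singleton_iff] at hv
    rcases hv with rfl | rfl
    · exact hzA
    · obtain ⟨w, hw⟩ := hzA
      refine ⟨W.Ω *ᵥ w, ?_⟩
      simp only [mulVecLin_apply] at hw ⊢
      rw [mulVec_mulVec, hA, ← mulVec_mulVec, hw]
  have hfin : Module.finrank k (Submodule.span k {z, W.Ω *ᵥ z}) = 2 := by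
    have h := finrank_span_eq_card (R := k) (linearIndependent_pair_mulVec W hΩ hd hz)
    have hr : Set.range ![z, W.Ω *ᵥ z] = {z, W.Ω *ᵥ z} := by
      ext v
      simp only [Set.mem_range, Set.mem_insert_iff, Set.mem_singleton_iff, Fin.exists_fin_two,
        Matrix.cons_val_zero, Matrix.cons_val_one]
      constructor
      · rintro (h | h) <;> [left; right] <;> exact h.symm
      · rintro (h | h) <;> [left; right] <;> exact h.symm
    rw [hr] at h
    simpa using h
  have hr' : Module.finrank k (LinearMap.range A.mulVecLin) = 2 := hr
  exact (Submodule.eq_of_le_of_finrank_eq hle (hfin.trans hr'.symm)).ge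

/-- a `k`-matrix and a `k`-vector, adelically: `adMat A *ᵥ (ι ∘ v) = ι ∘ (A *ᵥ v)`. -/
theorem adMat_mulVec_comp (A : Matrix (Fin 4) (Fin 4) k) (v : Fin 4 → k) :
    adMat k A *ᵥ ((algebraMap k (Ad k)) ∘ v) = (algebraMap k (Ad k)) ∘ (A *ᵥ v) := by
  funext i
  exact (RingHom.map_mulVec (algebraMap k (Ad k)) A v i).symm

/-- the columns of `adMat A` lie in the adelic span of `z, Ωz` when the columns of `A` lie in the `k`-span. -/
theorem mulVec_adMat_mem_span {A : Matrix (Fin 4) (Fin 4) k} {z : Fin 4 → k}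
    (hA : LinearMap.range A.mulVecLin ≤ Submodule.span k {z, W.Ω *ᵥ z}) (w : Fin 4 → Ad k) :
    adMat k A *ᵥ w ∈ Submodule.span (Ad k)
      {(algebraMap k (Ad k)) ∘ z, (algebraMap k (Ad k)) ∘ (W.Ω *ᵥ z)} := by
  set ι := algebraMap k (Ad k) with hι
  have hcol : ∀ j : Fin 4, adMat k A *ᵥ Pi.single j (1 : Ad k) ∈
      Submodule.span (Ad k) {ι ∘ z, ι ∘ (W.Ω *ᵥ z)} := by
    intro j
    have h1 : adMat k A *ᵥ Pi.single j (1 : Ad k) = ι ∘ (A *ᵥ Pi.single j (1 : k)) := by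
      rw [← adMat_mulVec_comp]
      congr 1
      funext i
      simp only [Function.comp_apply, Pi.single_apply]
      split_ifs <;> simp
    have h2 : A *ᵥ Pi.single j (1 : k) ∈ Submodule.span k {z, W.Ω *ᵥ z} := hA ⟨Pi.single j 1, rfl⟩
    obtain ⟨c, e, hce⟩ := Submodule.mem_span_pair.mp h2
    rw [h1, ← hce]
    have h3 : ι ∘ (c • z + e • W.Ω *ᵥ z) = ι c • (ι ∘ z) + ι e • (ι ∘ (W.Ω *ᵥ z)) := by
      funext i
      simp only [Function.comp_apply, Pi.add_apply, Pi.smul_apply, smul_eq_mul, map_add, map_mul]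
    rw [h3]
    exact Submodule.add_mem _ (Submodule.smul_mem _ _ (Submodule.subset_span (by simp)))
      (Submodule.smul_mem _ _ (Submodule.subset_span (by simp)))
  have hw : w = ∑ i, w i • Pi.single (M := fun _ => Ad k) i (1 : Ad k) := pi_eq_sum_univ' w
  rw [hw]
  have : adMat k A *ᵥ (∑ i, w i • Pi.single (M := fun _ => Ad k) i (1 : Ad k)) =
      ∑ i, w i • (adMat k A *ᵥ Pi.single i (1 : Ad k)) := by
    simp only [← mulVecLin_apply, map_sum, map_smul]
  rw [this]
  exact Submodule.sum_mem _ (fun i _ => Submodule.smul_mem _ _ (hcol i))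

/-- **three lines force a scalar**: an adelic unitary `t` commuting with the projectors `P 0`, `P 1` and with a rank-2
`Ω`-stable projector `f` whose image contains a `z` with `P 0 z ≠ 0 ≠ P 1 z` is an `E′`-scalar `c·1 + e·Ω`. -/
theorem mat_eq_scalar_of_three_lines {d : k} (hΩ : W.Ω * W.Ω = -(d • (1 : Matrix (Fin 4) (Fin 4) k)))
    (hd : ¬ IsSquare (-d)) (hP0 : (W.P 0).rank = 2) (hP1 : (W.P 1).rank = 2)
    {f : Matrix (Fin 4) (Fin 4) k} (hfΩ : f * W.Ω = W.Ω * f) (hfr : f.rank = 2)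
    {z : Fin 4 → k} (hzf : z ∈ LinearMap.range f.mulVecLin)
    (hx : W.P 0 *ᵥ z ≠ 0) (hy : W.P 1 *ᵥ z ≠ 0)
    (t : GA W) (ht0 : GA.mat W t * adMat k (W.P 0) = adMat k (W.P 0) * GA.mat W t)
    (ht1 : GA.mat W t * adMat k (W.P 1) = adMat k (W.P 1) * GA.mat W t)
    (htf : GA.mat W t * adMat k f = adMat k f * GA.mat W t) :
    ∃ c e : Ad k, GA.mat W t = c • (1 : M4 k) + e • adMat k W.Ω := by
  set ι := algebraMap k (Ad k) with hι
  set M := GA.mat W t with hM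
  have htΩ : M * adMat k W.Ω = adMat k W.Ω * M := ((mem_unitaryGroup W _).mp t.2).1
  have hz : z ≠ 0 := by
    intro h
    apply hx
    rw [h, mulVec_zero]
  have hspanf := range_le_span_pair W hΩ hd hfΩ hfr hz hzf
  have hxP : W.P 0 *ᵥ z ∈ LinearMap.range (W.P 0).mulVecLin := ⟨z, rfl⟩
  have hyP : W.P 1 *ᵥ z ∈ LinearMap.range (W.P 1).mulVecLin := ⟨z, rfl⟩
  have hspan0 := range_le_span_pair W hΩ hd (W.P_comm 0) hP0 hx hxP
  have hspan1 := range_le_span_pair W hΩ hd (W.P_comm 1) hP1 hy hyP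
  -- step 1: `t z ∈ span {z, Ωz}` adelically
  obtain ⟨z', hz'⟩ := hzf
  have hz'' : adMat k f *ᵥ (ι ∘ z') = ι ∘ z := by
    rw [adMat_mulVec_comp, ← hz']
    rfl
  have h1' : M *ᵥ (ι ∘ z) = adMat k f *ᵥ (M *ᵥ (ι ∘ z')) := by
    rw [← hz'', mulVec_mulVec, htf, ← mulVec_mulVec]
  have h1 : M *ᵥ (ι ∘ z) ∈ Submodule.span (Ad k) {ι ∘ z, ι ∘ (W.Ω *ᵥ z)} := by
    rw [h1']
    exact mulVec_adMat_mem_span W hspanf _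
  obtain ⟨c, e, hce⟩ := Submodule.mem_span_pair.mp h1
  refine ⟨c, e, ?_⟩
  -- the difference `N` kills `z`, hence `x, Ωx, y, Ωy`, hence everything
  set N : M4 k := M - (c • (1 : M4 k) + e • adMat k W.Ω) with hN
  have hcomm : ∀ A : Matrix (Fin 4) (Fin 4) k, M * adMat k A = adMat k A * M → A * W.Ω = W.Ω * A →
      N * adMat k A = adMat k A * N := by
    intro A hMA hAΩ
    have hΩA : adMat k W.Ω * adMat k A = adMat k A * adMat k W.Ω := by
      rw [← adMat_mul, ← hAΩ, adMat_mul]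
    rw [hN, sub_mul, mul_sub, add_mul, mul_add, smul_mul_assoc, mul_smul_comm, one_mul, mul_one,
      smul_mul_assoc, mul_smul_comm, hMA, hΩA]
  have hcommΩ : N * adMat k W.Ω = adMat k W.Ω * N := hcomm W.Ω htΩ rfl
  have hNz : N *ᵥ (ι ∘ z) = 0 := by
    rw [hN, sub_mulVec, add_mulVec, smul_mulVec, one_mulVec, smul_mulVec, adMat_mulVec_comp, ← hce,
      sub_self]
  have hkill : ∀ (A : Matrix (Fin 4) (Fin 4) k), N * adMat k A = adMat k A * N →
      N *ᵥ (ι ∘ (A *ᵥ z)) = 0 := by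
    intro A hNA
    rw [← adMat_mulVec_comp, mulVec_mulVec, hNA, ← mulVec_mulVec, hNz, mulVec_zero]
  have hkillΩ : ∀ v : Fin 4 → k, N *ᵥ (ι ∘ v) = 0 → N *ᵥ (ι ∘ (W.Ω *ᵥ v)) = 0 := by
    intro v hv
    rw [← adMat_mulVec_comp, mulVec_mulVec, hcommΩ, ← mulVec_mulVec, hv, mulVec_zero]
  have hNx := hkill (W.P 0) (hcomm _ ht0 (W.P_comm 0))
  have hNy := hkill (W.P 1) (hcomm _ ht1 (W.P_comm 1))
  have hNΩx := hkillΩ _ hNx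
  have hNΩy := hkillΩ _ hNy
  -- `N * adMat (P i) = 0`
  have hNP : ∀ (i : Fin 2) (v : Fin 4 → k),
      N *ᵥ (ι ∘ v) = 0 → N *ᵥ (ι ∘ (W.Ω *ᵥ v)) = 0 →
      LinearMap.range (W.P i).mulVecLin ≤ Submodule.span k {v, W.Ω *ᵥ v} →
      N * adMat k (W.P i) = 0 := by
    intro i v hv hΩv hsp
    have key : ∀ w : Fin 4 → Ad k, (N * adMat k (W.P i)) *ᵥ w = 0 := by
      intro w
      rw [← mulVec_mulVec]
      obtain ⟨a, b, hab⟩ := Submodule.mem_span_pair.mp (mulVec_adMat_mem_span W hsp w)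
      rw [← hab, mulVec_add, mulVec_smul, mulVec_smul, hv, hΩv, smul_zero, smul_zero, add_zero]
    ext i' j
    have h := congrFun (key (Pi.single j 1)) i'
    rw [mulVec_single_one] at h
    simpa using h
  have hNP0 := hNP 0 _ hNx hNΩx hspan0
  have hNP1 := hNP 1 _ hNy hNΩy hspan1
  have hN0 : N = 0 := by
    have h := W.P_sum
    calc N = N * adMat k (W.P 0 + W.P 1) := by rw [h, adMat_one, mul_one]
      _ = N * adMat k (W.P 0) + N * adMat k (W.P 1) := by rw [adMat_add, mul_add]
      _ = 0 := by rw [hNP0, hNP1, add_zero]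
  rw [hN] at hN0
  exact sub_eq_zero.mp hN0

/-- an `E′`-scalar `c·1 + e·Ω` is central in `U(W)(𝔸)` (every unitary commutes with `Ω`). -/
theorem mem_center_of_mat_eq_scalar (t : GA W) {c e : Ad k}
    (h : GA.mat W t = c • (1 : M4 k) + e • adMat k W.Ω) : t ∈ Subgroup.center (GA W) := by
  rw [Subgroup.mem_center_iff]
  intro g
  apply Subtype.ext
  apply Units.ext
  show GA.mat W g * GA.mat W t = GA.mat W t * GA.mat W g
  have hg : GA.mat W g * adMat k W.Ω = adMat k W.Ω * GA.mat W g := ((mem_unitaryGroup W _).mp g.2).1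
  rw [h, mul_add, add_mul, mul_smul_comm, smul_mul_assoc, mul_one, one_mul, mul_smul_comm,
    smul_mul_assoc, hg]

/-- an `E′`-line `im Q` different from both `P`-lines contains a vector with both `P`-components non-zero. -/
theorem exists_mem_range_components_ne_zero {d : k}
    (hΩ : W.Ω * W.Ω = -(d • (1 : Matrix (Fin 4) (Fin 4) k))) (hd : ¬ IsSquare (-d))
    (hP0 : (W.P 0).rank = 2) (hP1 : (W.P 1).rank = 2)
    {Q : Matrix (Fin 4) (Fin 4) k} (hQΩ : Q * W.Ω = W.Ω * Q) (hQr : Q.rank = 2)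
    (hQ0 : LinearMap.range Q.mulVecLin ≠ LinearMap.range (W.P 0).mulVecLin)
    (hQ1 : LinearMap.range Q.mulVecLin ≠ LinearMap.range (W.P 1).mulVecLin) :
    ∃ z ∈ LinearMap.range Q.mulVecLin, W.P 0 *ᵥ z ≠ 0 ∧ W.P 1 *ᵥ z ≠ 0 := by
  have hne : LinearMap.range Q.mulVecLin ≠ ⊥ := by
    intro h
    have h2 : Module.finrank k (LinearMap.range Q.mulVecLin) = 2 := hQr
    rw [h, finrank_bot] at h2
    exact absurd h2 (by norm_num)
  obtain ⟨z, hzQ, hz⟩ := Submodule.exists_mem_ne_zero_of_ne_bot hne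
  refine ⟨z, hzQ, ?_, ?_⟩
  -- a generic helper: if `P i z = 0` then `z ∈ im (P j)` for the other `j`, and then `im Q = im (P j)`
  · intro h0
    apply hQ1
    have hzP : z ∈ LinearMap.range (W.P 1).mulVecLin := by
      refine ⟨z, ?_⟩
      simp only [mulVecLin_apply]
      have := congrArg (fun A => A *ᵥ z) W.P_sum
      simp only [add_mulVec, one_mulVec, h0, zero_add] at this
      exact this
    have hle : LinearMap.range Q.mulVecLin ≤ LinearMap.range (W.P 1).mulVecLin := by
      refine (range_le_span_pair W hΩ hd hQΩ hQr hz hzQ).trans ?_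
      rw [Submodule.span_le]
      rintro v hv
      simp only [Set.mem_insert_iff, Set.mem_singleton_iff] at hv
      rcases hv with rfl | rfl
      · exact hzP
      · obtain ⟨w, hw⟩ := hzP
        refine ⟨W.Ω *ᵥ w, ?_⟩
        simp only [mulVecLin_apply] at hw ⊢
        rw [mulVec_mulVec, W.P_comm 1, ← mulVec_mulVec, hw]
    have h2 : Module.finrank k (LinearMap.range Q.mulVecLin) = 2 := hQr
    have h3 : Module.finrank k (LinearMap.range (W.P 1).mulVecLin) = 2 := hP1
    exact Submodule.eq_of_le_of_finrank_eq hle (h2.trans h3.symm)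
  · intro h0
    apply hQ0
    have hzP : z ∈ LinearMap.range (W.P 0).mulVecLin := by
      refine ⟨z, ?_⟩
      simp only [mulVecLin_apply]
      have := congrArg (fun A => A *ᵥ z) W.P_sum
      simp only [add_mulVec, one_mulVec, h0, add_zero] at this
      exact this
    have hle : LinearMap.range Q.mulVecLin ≤ LinearMap.range (W.P 0).mulVecLin := by
      refine (range_le_span_pair W hΩ hd hQΩ hQr hz hzQ).trans ?_
      rw [Submodule.span_le]
      rintro v hv
      simp only [Set.mem_insert_iff, Set.mem_singleton_iff] at hv
      rcases hv with rfl | rfl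
      · exact hzP
      · obtain ⟨w, hw⟩ := hzP
        refine ⟨W.Ω *ᵥ w, ?_⟩
        simp only [mulVecLin_apply] at hw ⊢
        rw [mulVec_mulVec, W.P_comm 0, ← mulVec_mulVec, hw]
    have h2 : Module.finrank k (LinearMap.range Q.mulVecLin) = 2 := hQr
    have h3 : Module.finrank k (LinearMap.range (W.P 0).mulVecLin) = 2 := hP0
    exact Submodule.eq_of_le_of_finrank_eq hle (h2.trans h3.symm)

/-- **the identity is regular when the tori differ**: for a genuine plane whose `T′`-line `im (Q 0)` is neither
`P`-line, `γ₀ = 1` is a regular rational element — `t⁻¹ · 1 · t′ = 1` forces `t′ = t ∈ T ∩ T′`, and an element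
preserving the three lines `im (P 0)`, `im (P 1)`, `im (Q 0)` is an `E′`-scalar, hence central. -/
theorem isRegularRational_one (hg : IsGenuine W)
    (hQ0 : LinearMap.range (W.Q 0).mulVecLin ≠ LinearMap.range (W.P 0).mulVecLin)
    (hQ1 : LinearMap.range (W.Q 0).mulVecLin ≠ LinearMap.range (W.P 1).mulVecLin) :
    IsRegularRational W 1 := by
  obtain ⟨⟨d, hΩ, hd⟩, -, -, -, hPr, hQr⟩ := hg
  intro t ht t' ht' hγ
  have h1 : t' = t := by
    have h : t⁻¹ * t' = 1 := by simpa using hγ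
    exact (inv_mul_eq_one.mp h).symm
  subst h1
  refine ⟨⟨⟨ht, ht'⟩, ?_⟩, rfl⟩
  obtain ⟨z, hzQ, hx, hy⟩ := exists_mem_range_components_ne_zero W hΩ hd (hPr 0) (hPr 1)
    (W.Q_comm 0) (hQr 0) hQ0 hQ1
  obtain ⟨c, e, hce⟩ := mat_eq_scalar_of_three_lines W hΩ hd (hPr 0) (hPr 1) (W.Q_comm 0) (hQr 0)
    hzQ hx hy t' ht.1 ht.2 ht'.1
  exact mem_center_of_mat_eq_scalar W t' hce

end Summit.Ventures.HodgeRepro.Tier4.Line1
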